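import Summits.CriticalPhenomena.CardyFormulaZ2.Theorems.CardyComplexConeParafermionToSLESixFamiliesDefs
import Literature.Probability.LatticeModels.MedialInterfaceProofs
import Literature.Probability.Percolation.BlockResampling

/-!
# The exact square-resampling identity `obs E z = ∫ condObs E Q ξ z dPc(ξ)` (glue for line `caratheodory-net-slit-uniformity`)

Crux `Summit.CriticalPhenomena.CardyFormulaZ2.Theses.CardyComplexCone.ParafermionToSLESixFamilies`
(stmt-CriticalPhenomena-11389), line `caratheodory-net-slit-uniformity`, registered glue
`obs_eq_integral_condObs` of stub `stub_carrierEquicontinuity` (card K2/P1, triage r1-1/r1-2 sharpening: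
condition on the FULL outer configuration).

For an admissible datum `E`, a finite set of sites `Q` and a medial vertex `z`,
`obs E z = ∫ ξ, condObs E Q ξ z ∂Pc`: the configuration `splice Q ξ ω` (inner edges of `Q` from `ω`,
all other edges from `ξ`) is the tree's `resample U (ξ, ω)` for the finite block `U` of inner edges of
`Q`, which under `Pc ⊗ Pc` is a fair sample of `Pc` (`map_resample_prod`, independence of disjoint edge
sets of the product Bernoulli measure); Fubini applies because the twisted passage sum of the exploration
is bounded uniformly in the configuration — the exploration of an admissible datum has at most
`#{inner corners} + 1` medial vertices (`length_medialExploration_le`, from the orbit description of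
`MedialInterfaceProofs`) and each passage contributes a unit complex number (`norm_passageSum_le_length`).

References: G. Grimmett, *Percolation*, 2nd ed. (1999), §2.2 (product structure of `P_p`);
O. Schramm, S. Smirnov, Ann. Probab. 39 (2011), §2 ("each `ω_j` is a fair sample");
S. Smirnov, C. R. Acad. Sci. Paris 333 (2001), §2.
-/

noncomputable section

open scoped Topology NNReal ENNReal BoundedContinuousFunction
open Filter Set MeasureTheory
open Literature.Probability Literature.Probability.LatticeModels Literature.Probability.Percolation
open Literature.Probability.RandomPlanarGeometry

namespace Summit.CriticalPhenomena.CardyFormulaZ2.Cruxes.ParafermionToSLESixFamilies.CaratheodoryNetSlitUniformity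

/-- **Uniform length bound.** For an admissible datum the medial exploration of every configuration has
at most `#{corners with inner face} + 1` medial vertices: its darts are carried by pairwise distinct
orbit corners with inner faces (`IsMedialExploration.dart_eq`, `cornerOrbit_ne`, `finite_innerCorners`). -/
theorem length_medialExploration_le (E : DiscreteDobrushin) (hE : E.IsZdAdmissible) :
    ∃ L : ℕ, ∀ ω : BondConfig (Site 2), (medialExploration E ω).length ≤ L + 1 := by
  classical
  obtain ⟨c₀, hc₀, -⟩ := DiscreteDobrushin.existsUnique_startCorner hE
  have hc₀' : E.IsStartCorner c₀ := ⟨hc₀.1, hc₀.2.1, hc₀.2.2⟩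
  set S : Finset (Site 2 × Fin 4) := (finite_innerCorners hE).toFinset with hS
  refine ⟨S.card, fun ω => ?_⟩
  have hγ : IsMedialExploration E ω (medialExploration E ω) :=
    isMedialExploration_medialExploration_holds E hE ω
  set n := (medialExploration E ω).length with hn
  have hinner : ∀ k < n - 1, E.IsInnerFace (cFace (cornerOrbit (E.bcBondConfig ω) c₀ k)) :=
    fun k hk => (hγ.dart_eq hE hc₀' k (by omega)).1
  have hmaps : Set.MapsTo (cornerOrbit (E.bcBondConfig ω) c₀) ↑(Finset.range (n - 1)) ↑S := by
    intro k hk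
    rw [Finset.coe_range, Set.mem_Iio] at hk
    rw [hS, Set.Finite.coe_toFinset]
    exact hinner k hk
  have hinj : Set.InjOn (cornerOrbit (E.bcBondConfig ω) c₀) ↑(Finset.range (n - 1)) := by
    intro i hi j hj h
    rw [Finset.coe_range, Set.mem_Iio] at hi hj
    by_contra hne
    rcases Nat.lt_or_gt_of_ne hne with hij | hij
    · exact cornerOrbit_ne hE hc₀' hij (fun k hk => hinner k (by omega)) h
    · exact cornerOrbit_ne hE hc₀' hij (fun k hk => hinner k (by omega)) h.symm
  have hcard := Finset.card_le_card_of_injOn _ hmaps hinj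
  rw [Finset.card_range] at hcard
  omega

/-- Each passage contributes a unit complex number, so the twisted passage sum of a medial path is
bounded by its length. -/
theorem norm_passageSum_le_length (γ : List MedialVertex) (δ spin : ℝ) (z : MedialVertex) :
    ‖MedialPath.passageSum γ δ spin z‖ ≤ γ.length := by
  rw [MedialPath.passageSum_eq]
  refine (norm_sum_le _ _).trans ?_
  have h1 : ∀ k ∈ (Finset.range γ.length).filter (fun k => γ[k]? = some z),
      ‖Complex.exp (-Complex.I * spin * (MedialPath.windingAt γ δ k : ℝ))‖ = 1 := by
    intro k _
    rw [Complex.norm_exp]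
    simp
  rw [Finset.sum_congr rfl h1, Finset.sum_const, nsmul_eq_mul, mul_one]
  exact_mod_cast (Finset.card_filter_le _ _).trans (Finset.card_range _).le

/-- The twisted passage sum of the exploration of an admissible datum is bounded uniformly in the
configuration. -/
theorem exists_norm_passageSum_medialExploration_le (E : DiscreteDobrushin) (hE : E.IsZdAdmissible)
    (spin : ℝ) (z : MedialVertex) :
    ∃ C : ℝ, ∀ ω : BondConfig (Site 2),
      ‖MedialPath.passageSum (medialExploration E ω) E.δ spin z‖ ≤ C := by
  obtain ⟨L, hL⟩ := length_medialExploration_le E hE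
  refine ⟨(L : ℝ) + 1, fun ω => (norm_passageSum_le_length _ _ _ _).trans ?_⟩
  exact_mod_cast hL ω

/-- The set of inner edges of a finite set of sites (both endpoints in `Q`) is finite. -/
theorem finite_innerEdges {Q : Set (Site 2)} (hQ : Q.Finite) :
    {e : Sym2 (Site 2) | ∀ x ∈ e, x ∈ Q}.Finite := by
  refine ((hQ.prod hQ).image fun p : Site 2 × Site 2 => s(p.1, p.2)).subset ?_
  rintro ⟨a, b⟩ he
  exact ⟨(a, b), ⟨he a (Sym2.mem_mk_left a b), he b (Sym2.mem_mk_right a b)⟩, rfl⟩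

/-- `splice` is the tree's block resampling on the inner edges of `Q`: `splice Q ξ ω = resample U (ξ, ω)`
with `U = {e | ∀ x ∈ e, x ∈ Q}`. -/
theorem splice_eq_resample (Q : Set (Site 2)) (ξ ω : BondConfig (Site 2)) :
    splice Q ξ ω = resample {e : Sym2 (Site 2) | ∀ x ∈ e, x ∈ Q} (ξ, ω) := by
  ext e
  simp only [splice, mem_resample_iff, Set.mem_setOf_eq]
  tauto

/-- **Registered glue `obs_eq_integral_condObs`** — the exact square-resampling identity: for an
admissible datum, a finite `Q` and any medial vertex `z`, the observable is the `Pc`-average over the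
outer configuration `ξ` of the conditional inner amplitude `condObs E Q ξ z` (independence of disjoint
edge sets under the product Bernoulli measure: `map_resample_prod`, plus Fubini for the bounded
measurable passage sum). -/
theorem obs_eq_integral_condObs : ∀ (E : DiscreteDobrushin), E.IsZdAdmissible → ∀ (Q : Set (Site 2)),
    Q.Finite → ∀ (z : MedialVertex), obs E z = ∫ ξ, condObs E Q ξ z ∂Pc := by
  intro E hE Q hQ z
  classical
  have hU := finite_innerEdges hQ
  have hBU : (↑hU.toFinset : Set (Sym2 (Site 2))) = {e : Sym2 (Site 2) | ∀ x ∈ e, x ∈ Q} :=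
    hU.coe_toFinset
  -- the integrand, measurable and bounded
  have hmeas : Measurable fun ω : BondConfig (Site 2) =>
      MedialPath.passageSum (medialExploration E ω) E.δ (1 / 3) z :=
    measurable_of_medialExploration E fun ω ω' h => by simp only [h]
  obtain ⟨C, hC⟩ := exists_norm_passageSum_medialExploration_le E hE (1 / 3) z
  -- `condObs` through `resample`
  have hcond : ∀ ξ : BondConfig (Site 2), condObs E Q ξ z =
      ∫ ω, MedialPath.passageSum (medialExploration E (resample ↑hU.toFinset (ξ, ω))) E.δ (1 / 3) z ∂Pc := by
    intro ξ
    simp only [condObs, splice_eq_resample, hBU]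
  simp_rw [hcond]
  -- Fubini on `Pc ⊗ Pc`
  have hint : Integrable (fun x : BondConfig (Site 2) × BondConfig (Site 2) =>
      MedialPath.passageSum (medialExploration E (resample ↑hU.toFinset x)) E.δ (1 / 3) z) (Pc.prod Pc) :=
    Integrable.of_bound ((hmeas.comp (measurable_resample _)).aestronglyMeasurable) C
      (ae_of_all _ fun x => hC _)
  have hfub : ∫ ξ, (∫ ω, MedialPath.passageSum (medialExploration E (resample ↑hU.toFinset (ξ, ω))) E.δ
      (1 / 3) z ∂Pc) ∂Pc = ∫ x, MedialPath.passageSum (medialExploration E (resample ↑hU.toFinset x)) E.δ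
      (1 / 3) z ∂(Pc.prod Pc) :=
    (integral_prod _ hint).symm
  rw [hfub, ← integral_map (measurable_resample _).aemeasurable hmeas.aestronglyMeasurable]
  -- the resampled configuration is a fair sample
  have hmap : (Pc.prod Pc).map (resample ↑hU.toFinset) = Pc := map_resample_prod (zdGraph 2) half _
  rw [hmap]
  rfl

end Summit.CriticalPhenomena.CardyFormulaZ2.Cruxes.ParafermionToSLESixFamilies.CaratheodoryNetSlitUniformity

end
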